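import Literature.Geometry.Riemannian.SphericalCylinderEntropySmallScales
import Literature.Geometry.Riemannian.EmbeddedSubmanifoldHausdorff
import Literature.Geometry.Lorentzian.GreenIdentity
import HarnessLib

/-!
# The typed cylinder density of an embedded compact cross-section is finite at every scale

Topic `Literature/Geometry/Riemannian`; continuation of `SphericalCylinderEntropy.lean` /
`SphericalCylinderEntropySmallScales.lean` (the typed kernel `cylKernel p τ` of route
`SmoothPoincare4/CylinderEntropy` is bounded on `N × N` at every `τ > 0`) and
`EmbeddedSubmanifoldHausdorff.lean` (the induced Riemannian measure of a compact embedded submanifold of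
a Euclidean space is `μHE`).  Proved here (everything; no facts, no definitions):

* `hausdorffMeasure_range_lt_top_of_isSpacelikeImmersion` — the image of a compact `m`-manifold under
  an injective Riemannian immersion into a Euclidean space has `μH[m] < ∞` (Mathlib's un-normalised
  Hausdorff measure; `μHE[m] = c • μH[m]`, `c ≠ 0`);
* `setLIntegral_cylKernel_lt_top`, `cylDensity_lt_top_of_measure_ne_top` — on a measurable `A ⊆ N` of
  finite `μH[4]`-measure the typed kernel integral and the typed density `F̂_{p,τ}(A)` are finite for
  every `p ∈ N`, `τ > 0`;
* `cylDensity_range_lt_top` — **`F̂_{p,τ}(Σ) < ∞` for every compact embedded cross-section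
  `Σ = range f ⊆ N`**, `p ∈ N`, `τ > 0`: the finiteness clause of Hamilton's monotonicity for the typed
  density (crux `CylinderRungTwo`, stub `stub_hamiltonMonotonicity`, hypothesis `DensityFinite` of the
  worker's reduction).

## References
* H. Federer, *Geometric Measure Theory* (1969), 3.2.3, 3.2.46.
* R. S. Hamilton, *Monotonicity formulas for parabolic flows on manifolds*, Comm. Anal. Geom. 1 (1993),
  127–137.
-/

noncomputable section

open scoped BigOperators Topology ENNReal Manifold ContDiff
open Filter Set MeasureTheory MeasureTheory.Measure Function

namespace Literature.Geometry.Riemannian.SphericalCylinderEntropy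

open Literature.Geometry.Lorentzian Literature.Geometry.Lorentzian.PseudoRiemannianMetric
open Literature.Geometry.Riemannian

/-! ### Finite Hausdorff measure of compact embedded submanifolds -/

section Embedded

variable {m : ℕ} {M : Type*} [TopologicalSpace M] [ChartedSpace (EuclideanSpace ℝ (Fin m)) M]
  [IsManifold (𝓡 m) ∞ M] [CompactSpace M] [T2Space M]
  {V : Type*} [NormedAddCommGroup V] [InnerProductSpace ℝ V] [MeasurableSpace V] [BorelSpace V]

/-- **The image of a compact manifold under an injective Riemannian immersion into a Euclidean space
has finite `m`-dimensional Hausdorff measure** (Mathlib's un-normalised `μH[m]`): the induced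
Riemannian measure is finite on the compact `M` and equals `μHE[m] = c • μH[m]` of the image
(`riemannianMeasure_induced_apply`), `c ≠ 0`. [cite: Federer1969, 3.2.3 and 3.2.46] -/
theorem hausdorffMeasure_range_lt_top_of_isSpacelikeImmersion {f : M → V}
    (hf : (euclideanMetric V).IsSpacelikeImmersion (𝓡 m) f) (hinj : Injective f) :
    μH[m] (Set.range f) < ⊤ := by
  borelize M
  haveI : IsFiniteMeasure (riemannianMeasure ((euclideanMetric V).inducedRiemannianMetric f
      contMDiff_pullbackBilin_holds hf)) := isFiniteMeasure_riemannianMeasure _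
  have h := riemannianMeasure_induced_apply hf hinj MeasurableSet.univ
  rw [Set.image_univ] at h
  have hfin : μHE[m] (Set.range f) < ⊤ := by rw [← h]; exact measure_lt_top _ _
  rw [Measure.euclideanHausdorffMeasure_def, Measure.smul_apply, ENNReal.smul_def, smul_eq_mul] at hfin
  refine lt_top_iff_ne_top.2 fun htop => ?_
  rw [htop, ENNReal.mul_top (by exact_mod_cast
    Measure.addHaarScalarFactor_volume_hausdorffMeasure_ne_zero m)] at hfin
  exact lt_irrefl _ hfin

end Embedded

/-! ### Finiteness of the typed density -/

/-- **The typed kernel integral over a subset of `N` of finite measure is finite**: for measurable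
`A ⊆ N` with `μH[4](A) < ∞`, `p ∈ N` and `τ > 0`, `∫_A ofReal(K_{p,τ}) dμH⁴ < ∞` (the kernel is
bounded on `N × N` at scale `τ`, `abs_cylKernel_le_majorant`). [folklore] -/
theorem setLIntegral_cylKernel_lt_top {A : Set (EuclideanSpace ℝ (Fin 6))} (hAm : MeasurableSet A)
    (hAN : ∀ z ∈ A, ∑ i : Fin 5, z (Fin.castSucc i) ^ 2 = 1) (hA : μH[4] A ≠ ⊤)
    {p : EuclideanSpace ℝ (Fin 6)} (hp : ∑ i : Fin 5, p (Fin.castSucc i) ^ 2 = 1)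
    {τ : ℝ} (hτ : 0 < τ) :
    ∫⁻ z in A, ENNReal.ofReal (cylKernel p τ z) ∂μH[4] < ⊤ := by
  set B : ℝ := ∑' k : ℕ, Real.exp (-((k : ℝ) * ((k : ℝ) + 3)) * τ) * 32 ^ k with hB
  have hbound : ∀ z ∈ A, ENNReal.ofReal (cylKernel p τ z) ≤ ENNReal.ofReal B := fun z hz =>
    ENNReal.ofReal_le_ofReal
      ((le_abs_self _).trans (abs_cylKernel_le_majorant hp (hAN z hz) hτ le_rfl))
  calc ∫⁻ z in A, ENNReal.ofReal (cylKernel p τ z) ∂μH[4]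
      ≤ ∫⁻ _ in A, ENNReal.ofReal B ∂μH[4] := setLIntegral_mono' hAm hbound
    _ = ENNReal.ofReal B * μH[4] A := setLIntegral_const _ _
    _ < ⊤ := ENNReal.mul_lt_top ENNReal.ofReal_lt_top (lt_top_iff_ne_top.2 hA)

/-- **The typed density of a finite-measure subset of `N` is finite** at every `p ∈ N`, `τ > 0`.
[folklore] -/
theorem cylDensity_lt_top_of_measure_ne_top {A : Set (EuclideanSpace ℝ (Fin 6))}
    (hAm : MeasurableSet A) (hAN : ∀ z ∈ A, ∑ i : Fin 5, z (Fin.castSucc i) ^ 2 = 1)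
    (hA : μH[4] A ≠ ⊤) {p : EuclideanSpace ℝ (Fin 6)} (hp : ∑ i : Fin 5, p (Fin.castSucc i) ^ 2 = 1)
    {τ : ℝ} (hτ : 0 < τ) : cylDensity A p τ < ⊤ := by
  rw [cylDensity]
  exact ENNReal.mul_lt_top (lt_top_iff_ne_top.2 inv_hausdorffMeasure_sphere_four_ne_zero_ne_top.2)
    (setLIntegral_cylKernel_lt_top hAm hAN hA hp hτ)

/-- **The typed density of a compact embedded cross-section of `N` is finite**: for an injective
Riemannian immersion `f` of a compact `4`-manifold into `ℝ⁶` with image in `N`, `p ∈ N` and `τ > 0`,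
`F̂_{p,τ}(range f) < ∞`. [folklore] -/
theorem cylDensity_range_lt_top {M : Type*} [TopologicalSpace M]
    [ChartedSpace (EuclideanSpace ℝ (Fin 4)) M] [IsManifold (𝓡 4) ∞ M] [CompactSpace M] [T2Space M]
    {f : M → EuclideanSpace ℝ (Fin 6)}
    (hf : (euclideanMetric (EuclideanSpace ℝ (Fin 6))).IsSpacelikeImmersion (𝓡 4) f)
    (hinj : Injective f) (hN : ∀ x, ∑ i : Fin 5, f x (Fin.castSucc i) ^ 2 = 1)
    {p : EuclideanSpace ℝ (Fin 6)} (hp : ∑ i : Fin 5, p (Fin.castSucc i) ^ 2 = 1)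
    {τ : ℝ} (hτ : 0 < τ) : cylDensity (Set.range f) p τ < ⊤ := by
  have hmeas : MeasurableSet (Set.range f) :=
    (isCompact_range hf.contMDiff.continuous).isClosed.measurableSet
  refine cylDensity_lt_top_of_measure_ne_top hmeas ?_
    (hausdorffMeasure_range_lt_top_of_isSpacelikeImmersion hf hinj).ne hp hτ
  rintro z ⟨x, rfl⟩
  exact hN x

end Literature.Geometry.Riemannian.SphericalCylinderEntropy

end
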